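import Summits.CriticalPhenomena.PercolationContinuityZ3.Theorems.PercNearOneGluingNoHeavyRsw3VolumeHyperscaling
import Summits.CriticalPhenomena.PercolationContinuityZ3.Theorems.PercAnnulusCrossingIICVolumeUpper
import HarnessLib

/-!
# RSW3 lane (P2, gen 21): KESTEN'S THEOREM (8) IN ALL MOMENTS, V-a — tools: the `t`-th moment of a count is the `t`-point sum;
# Markov for powers of the volume; the one-arm ratio inequalities at `p_c(ℤ^d)` under (A2)□, packaged

builds on p205010 (kernel theorem, internal audit signed; external expert review pending) — NOT used in this file.

Cell `prim-rsw3`, prover seat `prim-rsw3-p2` (gen 21), memo `run/shared/lean/prim/rsw3/P2-RSWLITE.md` §28.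
Support file (`--supports stmt-CriticalPhenomena-4575`); no definitions, no named facts, no sorries.

* `integral_card_filter_pow_eq_sum` (any finite measure, any finite family of measurable events): **`∫ (#{i ∈ B : ω ∈ A_i})^t dμ =
  Σ_{q : Fin t → B} μ(⋂_i A_{q_i})`**; restricted form `setIntegral_card_filter_pow_eq_sum`;
* `pow_mul_real_le_setIntegral_volume_pow` — Markov: `a^t · μ({a ≤ V_n} ∩ E) ≤ ∫_E V_n^t dμ` (`V_n = #{z ∈ Λ(n) : 0 ↔ z}`);
* `exists_ratios_of_setToSetQuasiMultAspectAt` — (R1), (R_lin), (R2), `p_c > 0`, `π_{p_c}(1) > 0` from (A2)□ (gens 19–20, p1 gen 7).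

References: H. Kesten, Probab. Theory Relat. Fields 73 (1986) 369–394, Thm. (8), (43) [Kesten1986]; D. Basu, A. Sapozhnikov, ECP 22
(2017), §1 (A2) [BasuSapozhnikov2017ECP]. [folklore]
-/

noncomputable section

namespace Summit.CriticalPhenomena.PercolationContinuityZ3.Theorems

namespace Rsw3

open MeasureTheory Literature.Probability.LatticeModels Literature.Probability.Percolation
open SurfaceTension Crossing SimpleGraph Finset

variable {d : ℕ}

/-! ## The `t`-th moment of a count is the `t`-point sum -/

/-- A product of `0/1` indicators is the indicator of the intersection. [folklore] -/
theorem prod_indicator_one_eq_indicator_iInter {Ω : Type*} {t : ℕ} (A : Fin t → Set Ω) (ω : Ω) :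
    ∏ i, (A i).indicator (1 : Ω → ℝ) ω = (⋂ i, A i).indicator (1 : Ω → ℝ) ω := by
  classical
  by_cases h : ω ∈ ⋂ i, A i
  · rw [Set.indicator_of_mem h, Pi.one_apply]
    refine Finset.prod_eq_one fun i _ => ?_
    rw [Set.indicator_of_mem (Set.mem_iInter.1 h i), Pi.one_apply]
  · rw [Set.indicator_of_notMem h]
    obtain ⟨i, hi⟩ : ∃ i, ω ∉ A i := by simpa [Set.mem_iInter] using h
    exact Finset.prod_eq_zero (Finset.mem_univ i) (Set.indicator_of_notMem hi _)

open Classical in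
/-- **THE `t`-TH MOMENT OF A COUNT IS THE `t`-POINT SUM** (any finite measure `μ`, any finite family of measurable events `A_i`, `i ∈ B`):
`∫ (#{i ∈ B : ω ∈ A_i})^t dμ(ω) = Σ_{q : Fin t → B} μ(⋂_i A_{q_i})` (expand the power of the sum of indicators, `Finset.sum_pow'`).
[cite: Kesten1986, Thm. (8), (43)] -/
theorem integral_card_filter_pow_eq_sum {Ω ι : Type*} [MeasurableSpace Ω] (μ : Measure Ω) [IsFiniteMeasure μ] [DecidableEq ι]
    (B : Finset ι) (A : ι → Set Ω) (hA : ∀ i ∈ B, MeasurableSet (A i)) (t : ℕ) :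
    ∫ ω, (((B.filter fun i => ω ∈ A i).card : ℕ) : ℝ) ^ t ∂μ =
      ∑ q ∈ Fintype.piFinset (fun _ : Fin t => B), μ.real (⋂ i, A (q i)) := by
  classical
  have hpt : ∀ ω, (((B.filter fun i => ω ∈ A i).card : ℕ) : ℝ) ^ t =
      ∑ q ∈ Fintype.piFinset (fun _ : Fin t => B), (⋂ i, A (q i)).indicator (1 : Ω → ℝ) ω := by
    intro ω
    rw [card_filter_mem_eq_sum_indicator, Finset.sum_pow']
    exact Finset.sum_congr rfl fun q _ => prod_indicator_one_eq_indicator_iInter (fun i => A (q i)) ω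
  have hmeas : ∀ q ∈ Fintype.piFinset (fun _ : Fin t => B), MeasurableSet (⋂ i, A (q i)) :=
    fun q hq => MeasurableSet.iInter fun i => hA _ (Fintype.mem_piFinset.1 hq i)
  have hind : ∀ E : Set Ω, MeasurableSet E → Integrable (E.indicator (1 : Ω → ℝ)) μ :=
    fun E hE => (integrable_const (1 : ℝ)).indicator hE
  simp_rw [hpt]
  rw [integral_finsetSum _ fun q hq => hind _ (hmeas q hq)]
  exact Finset.sum_congr rfl fun q hq => integral_indicator_one (hmeas q hq)

open Classical in
/-- **Restricted form**: `∫_E (#{i ∈ B : ω ∈ A_i})^t dμ = Σ_{q : Fin t → B} μ(⋂_i A_{q_i} ∩ E)` for a measurable `E`. [cite: Kesten1986, Thm. (8), (43)] -/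
theorem setIntegral_card_filter_pow_eq_sum {Ω ι : Type*} [MeasurableSpace Ω] (μ : Measure Ω) [IsFiniteMeasure μ] [DecidableEq ι]
    (B : Finset ι) (A : ι → Set Ω) (hA : ∀ i ∈ B, MeasurableSet (A i)) (E : Set Ω) (t : ℕ) :
    ∫ ω in E, (((B.filter fun i => ω ∈ A i).card : ℕ) : ℝ) ^ t ∂μ =
      ∑ q ∈ Fintype.piFinset (fun _ : Fin t => B), μ.real ((⋂ i, A (q i)) ∩ E) := by
  classical
  rw [integral_card_filter_pow_eq_sum (μ.restrict E) B A hA t]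
  refine Finset.sum_congr rfl fun q hq => ?_
  rw [measureReal_restrict_apply (MeasurableSet.iInter fun i => hA _ (Fintype.mem_piFinset.1 hq i))]

open Classical in
/-- The volume count `ω ↦ #{z ∈ Λ(n) : 0 ↔ z}` is measurable. [folklore] -/
theorem measurable_card_filter_openConn (n : ℕ) :
    Measurable fun ω : BondConfig (Site d) =>
      ((((box d n).filter fun z => ω ∈ (openConn (0 : Site d) z : Set (BondConfig (Site d)))).card : ℕ) : ℝ) := by
  classical
  have h : (fun ω : BondConfig (Site d) =>
      ((((box d n).filter fun z => ω ∈ (openConn (0 : Site d) z : Set (BondConfig (Site d)))).card : ℕ) : ℝ)) =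
      fun ω => ∑ z ∈ box d n, (openConn (0 : Site d) z : Set (BondConfig (Site d))).indicator 1 ω := by
    funext ω; exact card_filter_mem_eq_sum_indicator _ _ ω
  rw [h]
  exact Finset.measurable_sum _ fun z _ => measurable_const.indicator (measurableSet_openConn_holds (0 : Site d) z)

open Classical in
/-- **Markov for powers of the volume**: for a finite measure, `a ≥ 0` and any event `E`,
`a^t · μ({a ≤ V_n} ∩ E) ≤ ∫_E V_n^t dμ`. [folklore] -/
theorem pow_mul_real_le_setIntegral_volume_pow (μ : Measure (BondConfig (Site d))) [IsFiniteMeasure μ] (n t : ℕ) {a : ℝ}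
    (ha : 0 ≤ a) (E : Set (BondConfig (Site d))) :
    a ^ t * μ.real ({ω | a ≤ ((((box d n).filter fun z =>
        ω ∈ (openConn (0 : Site d) z : Set (BondConfig (Site d)))).card : ℕ) : ℝ)} ∩ E) ≤
      ∫ ω in E, ((((box d n).filter fun z => ω ∈ (openConn (0 : Site d) z : Set (BondConfig (Site d)))).card : ℕ) : ℝ) ^ t ∂μ := by
  classical
  set V : BondConfig (Site d) → ℝ := fun ω =>
    ((((box d n).filter fun z => ω ∈ (openConn (0 : Site d) z : Set (BondConfig (Site d)))).card : ℕ) : ℝ) with hV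
  have hVm : Measurable V := measurable_card_filter_openConn n
  have hV0 : ∀ ω, 0 ≤ V ω := fun ω => by simp only [hV]; exact Nat.cast_nonneg _
  have hVle : ∀ ω, V ω ≤ ((box d n).card : ℝ) := fun ω => by
    simp only [hV]; exact_mod_cast Finset.card_filter_le _ _
  have hVbdd : ∀ ω, V ω ^ t ≤ ((box d n).card : ℝ) ^ t := fun ω => pow_le_pow_left₀ (hV0 ω) (hVle ω) t
  have hint : Integrable (fun ω => V ω ^ t) (μ.restrict E) := by
    refine (integrable_const (((box d n).card : ℝ) ^ t)).mono' (hVm.pow_const t).aestronglyMeasurable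
      (Filter.Eventually.of_forall fun ω => ?_)
    rw [Real.norm_eq_abs, abs_of_nonneg (pow_nonneg (hV0 ω) t)]
    exact hVbdd ω
  have hmarkov := mul_meas_ge_le_integral_of_nonneg (μ := μ.restrict E) (f := fun ω => V ω ^ t)
    (Filter.Eventually.of_forall fun ω => pow_nonneg (hV0 ω) t) hint (a ^ t)
  refine le_trans ?_ hmarkov
  refine mul_le_mul_of_nonneg_left ?_ (pow_nonneg ha t)
  rw [measureReal_restrict_apply (measurableSet_le measurable_const (hVm.pow_const t))]
  refine measureReal_mono (fun ω hω => ⟨?_, hω.2⟩)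
  exact pow_le_pow_left₀ ha hω.1 t

/-! ## The ratio inequalities at `p_c(ℤ^d)` under (A2)□ -/

/-- **(R1), (R_lin), (R2) and positivity at `p_c(ℤ^d)` from (A2)□** (`d ≥ 2`, `2 ≤ s ≤ L`, `ϰ > 0`), packaged (gen 19
`exists_sq_oneArmProb_ratio_…`, `exists_oneArmProb_ratio_…`; p1 gen 7 `oneArmProb_mul_pow_le_of_oneArmQuasiMultAt`).
[cite: BasuSapozhnikov2017ECP, §1 assumption (A2)] [cite: Kesten1982, Cor. 5.1] -/
theorem exists_ratios_of_setToSetQuasiMultAspectAt (hd : 2 ≤ d) {s L : ℕ} (hs : 2 ≤ s) (hsL : s ≤ L) {ϰ : ℝ} (hϰ : 0 < ϰ)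
    (h : SetToSetQuasiMultAspectAt d (criticalProbI d) s L ϰ) :
    ∃ A A' B : ℝ, 0 ≤ A ∧ 0 ≤ A' ∧
      (∀ j n : ℕ, 1 ≤ j → j ≤ n → oneArmProb d (criticalProbI d) j ^ 2 * ((j : ℝ) / (16 * n)) ^ (d - 1) ≤
        A * oneArmProb d (criticalProbI d) n ^ 2) ∧
      (∀ j n : ℕ, 1 ≤ j → j ≤ n → oneArmProb d (criticalProbI d) j * ((j : ℝ) / (4 * n)) ^ (d - 1) ≤
        A' * oneArmProb d (criticalProbI d) n) ∧
      (∀ j n : ℕ, 1 ≤ j → j ≤ n → n ≤ 8 * j → oneArmProb d (criticalProbI d) j ≤ B * oneArmProb d (criticalProbI d) n) ∧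
      0 < ((criticalProbI d : unitInterval) : ℝ) ∧ 0 < oneArmProb d (criticalProbI d) 1 := by
  have hd1 : 1 ≤ d := by omega
  obtain ⟨A, hA, hR1⟩ := exists_sq_oneArmProb_ratio_of_setToSetQuasiMultAspectAt hd hs hsL hϰ h
  obtain ⟨B, hB, hR2⟩ := exists_oneArmProb_ratio_of_setToSetQuasiMultAspectAt hd hs hsL hϰ h
  obtain ⟨c, hc, hQM⟩ := oneArmQuasiMultAt_of_setToSetQuasiMultAspectAt hd hs hsL hϰ h
  have hpc : 0 < ((criticalProbI d : unitInterval) : ℝ) := by rw [coe_criticalProbI]; exact criticalProb_zd_pos d hd1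
  have hπ1 : 0 < oneArmProb d (criticalProbI d) 1 :=
    (pow_pos hpc 1).trans_le (DKT20.pow_le_real_siteToBoundary hd1 (criticalProbI d) 1)
  have hd0 : (0 : ℝ) < d := by exact_mod_cast (by omega : 0 < d)
  exact ⟨A, 2 * d / c, B, hA.le, by positivity, hR1, fun j n hj hjn => oneArmProb_mul_pow_le_of_oneArmQuasiMultAt hd hc hQM hj hjn,
    hR2, hpc, hπ1⟩

end Rsw3

end Summit.CriticalPhenomena.PercolationContinuityZ3.Theorems
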